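import Summits.Ventures.YMGap.RobustBall.OneStateStarSU3
import Summits.Ventures.YMGap.RobustBall.MassGapOnBallZdGRowsSU3PV2
import Summits.Ventures.YMGap.RobustBall.AreaLawRowsSU3PV2
import HarnessLib

/-!
# Venture YMGap, track ROBUST-BALL (Y2) — `SU(3)` HYPOTHESIS-FREE ONE-STATE cells on the centred Schwinger–Dyson (PV2) star cells (`ℤ⁴`)

HONEST FRAMING. WHAT THIS IS: a venture file (cell `pub-ymgap`, track Y2 ROBUST-BALL, seat engine-2 (g10); 0 compute).  ds-3's one-state
composition `oneState_onBallZdG` (a `ℤ⁴` mass-gap cell × a torus area-law cell at the same loads ⇒ for every member of the gauge-invariant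
tier-1 ball: EXACTLY ONE DLR state = the infinite-volume limit of the member's PERIODISED torus states, massive, plaquette–plaquette decay,
Wilson area law with one `(C, c)` per range) applied to THIS SEAT's hypothesis-free `SU(3)` PV2 cells: the `ℤ⁴` star cells of
`MassGapOnBallZdGRowsSU3PV2` (`su3_massGapOnBallZdG_pv2Star_*`) × the PV2 pair-door area law `RobustBallPV.su3_areaLawOnBall_pv2` at the same
`(β_W, 2ε, ε)` (the area-law radius at these couplings is far above the star `ε`).  Class K outright (no displayed hypothesis).
* schema `su3_oneState_of_pv2Star_row`: a PV2 area-law certificate at `(β_W, ε)` + a `MassGapOnBallZdG 4 3 (β_W/9) (2ε) ε R` cell ⇒ one state;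
* cells `su3_oneState_pv2Star_*` `(β_W, ε)`: (1/8, .269) (1/6, .223) (1/5, .185) (1/4, .127) (27/100, .103) (3/10, .065) (31/100, .052) (1/3, .020) (17/50, .011).
WHAT MOVES: the hypothesis-free `SU(3)` one-state cells were engine-2 g9's `OneStateStarSU3PV` (1/8, .150) … (31/100, .005) (frontier `31/100`);
every cell here is larger and the frontier moves `31/100 → 17/50`.  The one-state cells GIVEN H1, H2 (`OneStateStarSU3Certified`, to `11/20`) are
untouched.  NOT CLAIMED: existence of the string tension for a non-Wilson member (only `HasAreaLawWith μ χ C c`); a range-uniform `(C, c)`;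
anything at weak coupling, about the continuum limit or the Millennium problem.

References: ds-3's `RobustBall/OneState.lean`, `OneStateStarSU3.lean`; this seat's `MassGapOnBallZdGRowsSU3PV2.lean`, `AreaLawRowsSU3PV2.lean`,
`Thresholds/OneLinkVarianceSDCentred.lean`; certificates `HOME/pub-ymgap-engine-2/pv2/cert_rows.json`.
-/

noncomputable section

open MeasureTheory Filter Topology Function Finset
open scoped NNReal
open Literature.Probability.LatticeModels
open Literature.MathematicalPhysics.QuantumLattice hiding torusNorm
open Literature.MathematicalPhysics.QuantumFieldTheory hiding ZdEdge Site
open Literature.Barriers.QuantumFields (IsMassiveState)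
open Summit.Ventures.YMGap.RobustBallPV (su3_areaLawOnBall_pv2)

namespace Summit.Ventures.YMGap.RobustBall

/-- **SCHEMA, `SU(3)`, `ℤ⁴`, HYPOTHESIS-FREE one state on a PV2 star cell**: a PV2 pair-door area-law certificate at `(β_W, ε)` (radius
`R_al ≥ 2β_W/3`, `τ > 1`, envelope `K_s, s₀`, `T(2ε)(6(β_W/9)K_s) + T(ε)s₀ε < 1`) and a cell `MassGapOnBallZdG 4 3 (β_W/9) ε₀ ε R` with `ε₀ = 2ε`
give ds-3's five one-state clauses for every member of `MemBallZdG ε₀ ε R`. [folklore] -/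
theorem su3_oneState_of_pv2Star_row {βW ε₀ ε Ral τ Ks s₀ : ℝ} {R : ℕ} (h2 : 2 * ε = ε₀) (hε : 0 ≤ ε) (hβ0 : 0 ≤ βW)
    (hR : βW / 9 * (2 * ((3 : ℕ) : ℝ)) ≤ Ral) (hR2 : Ral < 1 / 2) (hτ : 1 < τ) (hKs0 : 0 ≤ Ks)
    (hKs : 16 * τ * (τ - 1) + 9 * τ ^ 3 * Ral ^ 2 ≤ 16 * (τ - 1) * (Ks ^ 2 * (1 / 2 - Ral))) (hs0 : 0 ≤ s₀)
    (hs : 1 ≤ 3 * s₀ ^ 2 * (1 / 2 - Ral)) (hε1 : ε ≤ 1 / 2)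
    (hcert : (1 + 2 * ε + (2 * ε) ^ 2 / 2 + (2 * ε) ^ 3 / 6 + 5 / 96 * (2 * ε) ^ 4) * (2 * ((3 : ℕ) : ℝ) * (βW / 9) * Ks) +
      (1 + ε + ε ^ 2 / 2 + ε ^ 3 / 6 + 5 / 96 * ε ^ 4) * s₀ * ε < 1)
    (hgap : MassGapOnBallZdG 4 3 (βW / 9) ε₀ ε R) :
    ∃ C c : ℝ, 0 < c ∧ ∀ (W : Potential (ZdEdge 4) (SUN 3)) (supp : Finset (ZdEdge 4) → Finset (Finset (ZdEdge 4)))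
      (hmem : MemBallZdG ε₀ ε R W supp) (hdep : ∀ X, DependsOn (W X) (↑X : Set (ZdEdge 4)))
      (hg : ∀ X, IsZdGaugeInvariant (W X)) (hm : ∀ X, Measurable (W X)) (hb : ∀ X, ∃ C, ∀ U, |W X U| ≤ C),
      ∃ μ : Measure (LGConfig 4 (SUN 3)),
        perturbedGibbsMeasures (d := 4) (fundamentalRep (Fin 3)) (((3 : ℕ) : ℝ) * (βW / 9)) W supp = {μ} ∧
        perturbedLimitPoints (((3 : ℕ) : ℝ) * (βW / 9)) (periodisedFamily W supp hdep hg hm hb) = {μ} ∧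
        IsMassiveState μ ∧ HasExponentialDecay (plaquetteCorrFn (fundamentalRep (Fin 3)) μ) ∧
        HasAreaLawWith μ (fun g => normalisedCharacter 3 (fundamentalRep (Fin 3) g)) C c := by
  have hA := su3_areaLawOnBall_pv2 (n := 3) R (mv := 2 * R + 1) (by omega) hβ0 hR hR2 hτ hKs0 hKs hs0 hs hε hε1 hcert
  have e : βW / 3 = ((3 : ℕ) : ℝ) * (βW / 9) := by push_cast; ring
  rw [e, h2] at hA
  exact oneState_onBallZdG (N := 3) (by norm_num) (by linarith) hε hgap hA

/-! ### Cells by name (hypothesis-free) -/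

/-- **`SU(3)`, `ℤ⁴`, `β_W = 1/8`, HYPOTHESIS-FREE**: every member of the gauge-invariant tier-1 ball `MemBallZdG (269 / 500) (269 / 1000) R` added to
`SU(3)` Wilson at `β_W = 1/8` ('t Hooft `1 / 72`) has ONE state (unique DLR state = periodised-torus limit, massive, plaquette decay, area law;
one `(C, c)` per `R`) — `su3_massGapOnBallZdG_pv2Star_oneEighth` × the PV2 area law at the same loads (certificate `τ = 531 / 500`, `K_s = 6609 / 4000`,
`s₀ = 223607 / 250000`). [folklore] -/
theorem su3_oneState_pv2Star_oneEighth (R : ℕ) :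
    ∃ C c : ℝ, 0 < c ∧ ∀ (W : Potential (ZdEdge 4) (SUN 3)) (supp : Finset (ZdEdge 4) → Finset (Finset (ZdEdge 4)))
      (hmem : MemBallZdG (269 / 500) (269 / 1000) R W supp) (hdep : ∀ X, DependsOn (W X) (↑X : Set (ZdEdge 4)))
      (hg : ∀ X, IsZdGaugeInvariant (W X)) (hm : ∀ X, Measurable (W X)) (hb : ∀ X, ∃ C, ∀ U, |W X U| ≤ C),
      ∃ μ : Measure (LGConfig 4 (SUN 3)),
        perturbedGibbsMeasures (d := 4) (fundamentalRep (Fin 3)) (((3 : ℕ) : ℝ) * ((1 / 8 : ℝ) / 9)) W supp = {μ} ∧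
        perturbedLimitPoints (((3 : ℕ) : ℝ) * ((1 / 8 : ℝ) / 9)) (periodisedFamily W supp hdep hg hm hb) = {μ} ∧
        IsMassiveState μ ∧ HasExponentialDecay (plaquetteCorrFn (fundamentalRep (Fin 3)) μ) ∧
        HasAreaLawWith μ (fun g => normalisedCharacter 3 (fundamentalRep (Fin 3) g)) C c := by
  have hgap : MassGapOnBallZdG 4 3 ((1 / 8 : ℝ) / 9) (269 / 500) (269 / 1000) R := by
    have h := su3_massGapOnBallZdG_pv2Star_oneEighth R; norm_num at h ⊢; exact h
  exact su3_oneState_of_pv2Star_row (Ral := 1 / 12) (τ := 531 / 500) (Ks := 6609 / 4000) (s₀ := 223607 / 250000)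
    (by norm_num) (by norm_num) (by norm_num) (by norm_num) (by norm_num) (by norm_num) (by norm_num) (by norm_num) (by norm_num) (by norm_num)
    (by norm_num) (by norm_num) hgap

/-- **`SU(3)`, `ℤ⁴`, `β_W = 1/6`, HYPOTHESIS-FREE**: every member of the gauge-invariant tier-1 ball `MemBallZdG (223 / 500) (223 / 1000) R` added to
`SU(3)` Wilson at `β_W = 1/6` ('t Hooft `1 / 54`) has ONE state (unique DLR state = periodised-torus limit, massive, plaquette decay, area law;
one `(C, c)` per `R`) — `su3_massGapOnBallZdG_pv2Star_oneSixth` × the PV2 area law at the same loads (certificate `τ = 541 / 500`, `K_s = 43719 / 25000`,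
`s₀ = 925821 / 1000000`). [folklore] -/
theorem su3_oneState_pv2Star_oneSixth (R : ℕ) :
    ∃ C c : ℝ, 0 < c ∧ ∀ (W : Potential (ZdEdge 4) (SUN 3)) (supp : Finset (ZdEdge 4) → Finset (Finset (ZdEdge 4)))
      (hmem : MemBallZdG (223 / 500) (223 / 1000) R W supp) (hdep : ∀ X, DependsOn (W X) (↑X : Set (ZdEdge 4)))
      (hg : ∀ X, IsZdGaugeInvariant (W X)) (hm : ∀ X, Measurable (W X)) (hb : ∀ X, ∃ C, ∀ U, |W X U| ≤ C),
      ∃ μ : Measure (LGConfig 4 (SUN 3)),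
        perturbedGibbsMeasures (d := 4) (fundamentalRep (Fin 3)) (((3 : ℕ) : ℝ) * ((1 / 6 : ℝ) / 9)) W supp = {μ} ∧
        perturbedLimitPoints (((3 : ℕ) : ℝ) * ((1 / 6 : ℝ) / 9)) (periodisedFamily W supp hdep hg hm hb) = {μ} ∧
        IsMassiveState μ ∧ HasExponentialDecay (plaquetteCorrFn (fundamentalRep (Fin 3)) μ) ∧
        HasAreaLawWith μ (fun g => normalisedCharacter 3 (fundamentalRep (Fin 3) g)) C c := by
  have hgap : MassGapOnBallZdG 4 3 ((1 / 6 : ℝ) / 9) (223 / 500) (223 / 1000) R := by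
    have h := su3_massGapOnBallZdG_pv2Star_oneSixth R; norm_num at h ⊢; exact h
  exact su3_oneState_of_pv2Star_row (Ral := 1 / 9) (τ := 541 / 500) (Ks := 43719 / 25000) (s₀ := 925821 / 1000000)
    (by norm_num) (by norm_num) (by norm_num) (by norm_num) (by norm_num) (by norm_num) (by norm_num) (by norm_num) (by norm_num) (by norm_num)
    (by norm_num) (by norm_num) hgap

/-- **`SU(3)`, `ℤ⁴`, `β_W = 1/5`, HYPOTHESIS-FREE**: every member of the gauge-invariant tier-1 ball `MemBallZdG (37 / 100) (37 / 200) R` added to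
`SU(3)` Wilson at `β_W = 1/5` ('t Hooft `1 / 45`) has ONE state (unique DLR state = periodised-torus limit, massive, plaquette decay, area law;
one `(C, c)` per `R`) — `su3_massGapOnBallZdG_pv2Star_oneFifth` × the PV2 area law at the same loads (certificate `τ = 549 / 500`, `K_s = 22923 / 12500`,
`s₀ = 953463 / 1000000`). [folklore] -/
theorem su3_oneState_pv2Star_oneFifth (R : ℕ) :
    ∃ C c : ℝ, 0 < c ∧ ∀ (W : Potential (ZdEdge 4) (SUN 3)) (supp : Finset (ZdEdge 4) → Finset (Finset (ZdEdge 4)))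
      (hmem : MemBallZdG (37 / 100) (37 / 200) R W supp) (hdep : ∀ X, DependsOn (W X) (↑X : Set (ZdEdge 4)))
      (hg : ∀ X, IsZdGaugeInvariant (W X)) (hm : ∀ X, Measurable (W X)) (hb : ∀ X, ∃ C, ∀ U, |W X U| ≤ C),
      ∃ μ : Measure (LGConfig 4 (SUN 3)),
        perturbedGibbsMeasures (d := 4) (fundamentalRep (Fin 3)) (((3 : ℕ) : ℝ) * ((1 / 5 : ℝ) / 9)) W supp = {μ} ∧
        perturbedLimitPoints (((3 : ℕ) : ℝ) * ((1 / 5 : ℝ) / 9)) (periodisedFamily W supp hdep hg hm hb) = {μ} ∧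
        IsMassiveState μ ∧ HasExponentialDecay (plaquetteCorrFn (fundamentalRep (Fin 3)) μ) ∧
        HasAreaLawWith μ (fun g => normalisedCharacter 3 (fundamentalRep (Fin 3) g)) C c := by
  have hgap : MassGapOnBallZdG 4 3 ((1 / 5 : ℝ) / 9) (37 / 100) (37 / 200) R := by
    have h := su3_massGapOnBallZdG_pv2Star_oneFifth R; norm_num at h ⊢; exact h
  exact su3_oneState_of_pv2Star_row (Ral := 2 / 15) (τ := 549 / 500) (Ks := 22923 / 12500) (s₀ := 953463 / 1000000)
    (by norm_num) (by norm_num) (by norm_num) (by norm_num) (by norm_num) (by norm_num) (by norm_num) (by norm_num) (by norm_num) (by norm_num)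
    (by norm_num) (by norm_num) hgap

/-- **`SU(3)`, `ℤ⁴`, `β_W = 1/4`, HYPOTHESIS-FREE**: every member of the gauge-invariant tier-1 ball `MemBallZdG (127 / 500) (127 / 1000) R` added to
`SU(3)` Wilson at `β_W = 1/4` ('t Hooft `1 / 36`) has ONE state (unique DLR state = periodised-torus limit, massive, plaquette decay, area law;
one `(C, c)` per `R`) — `su3_massGapOnBallZdG_pv2Star_oneQuarter` × the PV2 area law at the same loads (certificate `τ = 561 / 500`, `K_s = 39541 / 20000`,
`s₀ = 1`). [folklore] -/
theorem su3_oneState_pv2Star_oneQuarter (R : ℕ) :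
    ∃ C c : ℝ, 0 < c ∧ ∀ (W : Potential (ZdEdge 4) (SUN 3)) (supp : Finset (ZdEdge 4) → Finset (Finset (ZdEdge 4)))
      (hmem : MemBallZdG (127 / 500) (127 / 1000) R W supp) (hdep : ∀ X, DependsOn (W X) (↑X : Set (ZdEdge 4)))
      (hg : ∀ X, IsZdGaugeInvariant (W X)) (hm : ∀ X, Measurable (W X)) (hb : ∀ X, ∃ C, ∀ U, |W X U| ≤ C),
      ∃ μ : Measure (LGConfig 4 (SUN 3)),
        perturbedGibbsMeasures (d := 4) (fundamentalRep (Fin 3)) (((3 : ℕ) : ℝ) * ((1 / 4 : ℝ) / 9)) W supp = {μ} ∧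
        perturbedLimitPoints (((3 : ℕ) : ℝ) * ((1 / 4 : ℝ) / 9)) (periodisedFamily W supp hdep hg hm hb) = {μ} ∧
        IsMassiveState μ ∧ HasExponentialDecay (plaquetteCorrFn (fundamentalRep (Fin 3)) μ) ∧
        HasAreaLawWith μ (fun g => normalisedCharacter 3 (fundamentalRep (Fin 3) g)) C c := by
  have hgap : MassGapOnBallZdG 4 3 ((1 / 4 : ℝ) / 9) (127 / 500) (127 / 1000) R := by
    have h := su3_massGapOnBallZdG_pv2Star_oneQuarter R; norm_num at h ⊢; exact h
  exact su3_oneState_of_pv2Star_row (Ral := 1 / 6) (τ := 561 / 500) (Ks := 39541 / 20000) (s₀ := 1)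
    (by norm_num) (by norm_num) (by norm_num) (by norm_num) (by norm_num) (by norm_num) (by norm_num) (by norm_num) (by norm_num) (by norm_num)
    (by norm_num) (by norm_num) hgap

/-- **`SU(3)`, `ℤ⁴`, `β_W = 27/100`, HYPOTHESIS-FREE**: every member of the gauge-invariant tier-1 ball `MemBallZdG (103 / 500) (103 / 1000) R` added to
`SU(3)` Wilson at `β_W = 27/100` ('t Hooft `3 / 100`) has ONE state (unique DLR state = periodised-torus limit, massive, plaquette decay, area law;
one `(C, c)` per `R`) — `su3_massGapOnBallZdG_pv2Star_twentySevenHundredths` × the PV2 area law at the same loads (certificate `τ = 113 / 100`, `K_s = 51011 / 25000`,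
`s₀ = 1020621 / 1000000`). [folklore] -/
theorem su3_oneState_pv2Star_twentySevenHundredths (R : ℕ) :
    ∃ C c : ℝ, 0 < c ∧ ∀ (W : Potential (ZdEdge 4) (SUN 3)) (supp : Finset (ZdEdge 4) → Finset (Finset (ZdEdge 4)))
      (hmem : MemBallZdG (103 / 500) (103 / 1000) R W supp) (hdep : ∀ X, DependsOn (W X) (↑X : Set (ZdEdge 4)))
      (hg : ∀ X, IsZdGaugeInvariant (W X)) (hm : ∀ X, Measurable (W X)) (hb : ∀ X, ∃ C, ∀ U, |W X U| ≤ C),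
      ∃ μ : Measure (LGConfig 4 (SUN 3)),
        perturbedGibbsMeasures (d := 4) (fundamentalRep (Fin 3)) (((3 : ℕ) : ℝ) * ((27 / 100 : ℝ) / 9)) W supp = {μ} ∧
        perturbedLimitPoints (((3 : ℕ) : ℝ) * ((27 / 100 : ℝ) / 9)) (periodisedFamily W supp hdep hg hm hb) = {μ} ∧
        IsMassiveState μ ∧ HasExponentialDecay (plaquetteCorrFn (fundamentalRep (Fin 3)) μ) ∧
        HasAreaLawWith μ (fun g => normalisedCharacter 3 (fundamentalRep (Fin 3) g)) C c := by
  have hgap : MassGapOnBallZdG 4 3 ((27 / 100 : ℝ) / 9) (103 / 500) (103 / 1000) R := by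
    have h := su3_massGapOnBallZdG_pv2Star_twentySevenHundredths R; norm_num at h ⊢; exact h
  exact su3_oneState_of_pv2Star_row (Ral := 9 / 50) (τ := 113 / 100) (Ks := 51011 / 25000) (s₀ := 1020621 / 1000000)
    (by norm_num) (by norm_num) (by norm_num) (by norm_num) (by norm_num) (by norm_num) (by norm_num) (by norm_num) (by norm_num) (by norm_num)
    (by norm_num) (by norm_num) hgap

/-- **`SU(3)`, `ℤ⁴`, `β_W = 3/10`, HYPOTHESIS-FREE**: every member of the gauge-invariant tier-1 ball `MemBallZdG (13 / 100) (13 / 200) R` added to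
`SU(3)` Wilson at `β_W = 3/10` ('t Hooft `1 / 30`) has ONE state (unique DLR state = periodised-torus limit, massive, plaquette decay, area law;
one `(C, c)` per `R`) — `su3_massGapOnBallZdG_pv2Star_threeTenths` × the PV2 area law at the same loads (certificate `τ = 143 / 125`, `K_s = 53579 / 25000`,
`s₀ = 1054093 / 1000000`). [folklore] -/
theorem su3_oneState_pv2Star_threeTenths (R : ℕ) :
    ∃ C c : ℝ, 0 < c ∧ ∀ (W : Potential (ZdEdge 4) (SUN 3)) (supp : Finset (ZdEdge 4) → Finset (Finset (ZdEdge 4)))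
      (hmem : MemBallZdG (13 / 100) (13 / 200) R W supp) (hdep : ∀ X, DependsOn (W X) (↑X : Set (ZdEdge 4)))
      (hg : ∀ X, IsZdGaugeInvariant (W X)) (hm : ∀ X, Measurable (W X)) (hb : ∀ X, ∃ C, ∀ U, |W X U| ≤ C),
      ∃ μ : Measure (LGConfig 4 (SUN 3)),
        perturbedGibbsMeasures (d := 4) (fundamentalRep (Fin 3)) (((3 : ℕ) : ℝ) * ((3 / 10 : ℝ) / 9)) W supp = {μ} ∧
        perturbedLimitPoints (((3 : ℕ) : ℝ) * ((3 / 10 : ℝ) / 9)) (periodisedFamily W supp hdep hg hm hb) = {μ} ∧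
        IsMassiveState μ ∧ HasExponentialDecay (plaquetteCorrFn (fundamentalRep (Fin 3)) μ) ∧
        HasAreaLawWith μ (fun g => normalisedCharacter 3 (fundamentalRep (Fin 3) g)) C c := by
  have hgap : MassGapOnBallZdG 4 3 ((3 / 10 : ℝ) / 9) (13 / 100) (13 / 200) R := by
    have h := su3_massGapOnBallZdG_pv2Star_threeTenths R; norm_num at h ⊢; exact h
  exact su3_oneState_of_pv2Star_row (Ral := 1 / 5) (τ := 143 / 125) (Ks := 53579 / 25000) (s₀ := 1054093 / 1000000)
    (by norm_num) (by norm_num) (by norm_num) (by norm_num) (by norm_num) (by norm_num) (by norm_num) (by norm_num) (by norm_num) (by norm_num)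
    (by norm_num) (by norm_num) hgap

/-- **`SU(3)`, `ℤ⁴`, `β_W = 31/100`, HYPOTHESIS-FREE**: every member of the gauge-invariant tier-1 ball `MemBallZdG (13 / 125) (13 / 250) R` added to
`SU(3)` Wilson at `β_W = 31/100` ('t Hooft `31 / 900`) has ONE state (unique DLR state = periodised-torus limit, massive, plaquette decay, area law;
one `(C, c)` per `R`) — `su3_massGapOnBallZdG_pv2Star_thirtyOneHundredths` × the PV2 area law at the same loads (certificate `τ = 287 / 250`, `K_s = 108983 / 50000`,
`s₀ = 266501 / 250000`). [folklore] -/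
theorem su3_oneState_pv2Star_thirtyOneHundredths (R : ℕ) :
    ∃ C c : ℝ, 0 < c ∧ ∀ (W : Potential (ZdEdge 4) (SUN 3)) (supp : Finset (ZdEdge 4) → Finset (Finset (ZdEdge 4)))
      (hmem : MemBallZdG (13 / 125) (13 / 250) R W supp) (hdep : ∀ X, DependsOn (W X) (↑X : Set (ZdEdge 4)))
      (hg : ∀ X, IsZdGaugeInvariant (W X)) (hm : ∀ X, Measurable (W X)) (hb : ∀ X, ∃ C, ∀ U, |W X U| ≤ C),
      ∃ μ : Measure (LGConfig 4 (SUN 3)),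
        perturbedGibbsMeasures (d := 4) (fundamentalRep (Fin 3)) (((3 : ℕ) : ℝ) * ((31 / 100 : ℝ) / 9)) W supp = {μ} ∧
        perturbedLimitPoints (((3 : ℕ) : ℝ) * ((31 / 100 : ℝ) / 9)) (periodisedFamily W supp hdep hg hm hb) = {μ} ∧
        IsMassiveState μ ∧ HasExponentialDecay (plaquetteCorrFn (fundamentalRep (Fin 3)) μ) ∧
        HasAreaLawWith μ (fun g => normalisedCharacter 3 (fundamentalRep (Fin 3) g)) C c := by
  have hgap : MassGapOnBallZdG 4 3 ((31 / 100 : ℝ) / 9) (13 / 125) (13 / 250) R := by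
    have h := su3_massGapOnBallZdG_pv2Star_thirtyOneHundredths R; norm_num at h ⊢; exact h
  exact su3_oneState_of_pv2Star_row (Ral := 31 / 150) (τ := 287 / 250) (Ks := 108983 / 50000) (s₀ := 266501 / 250000)
    (by norm_num) (by norm_num) (by norm_num) (by norm_num) (by norm_num) (by norm_num) (by norm_num) (by norm_num) (by norm_num) (by norm_num)
    (by norm_num) (by norm_num) hgap

/-- **`SU(3)`, `ℤ⁴`, `β_W = 1/3`, HYPOTHESIS-FREE**: every member of the gauge-invariant tier-1 ball `MemBallZdG (1 / 25) (1 / 50) R` added to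
`SU(3)` Wilson at `β_W = 1/3` ('t Hooft `1 / 27`) has ONE state (unique DLR state = periodised-torus limit, massive, plaquette decay, area law;
one `(C, c)` per `R`) — `su3_massGapOnBallZdG_pv2Star_oneThird` × the PV2 area law at the same loads (certificate `τ = 29 / 25`, `K_s = 226971 / 100000`,
`s₀ = 547723 / 500000`). [folklore] -/
theorem su3_oneState_pv2Star_oneThird (R : ℕ) :
    ∃ C c : ℝ, 0 < c ∧ ∀ (W : Potential (ZdEdge 4) (SUN 3)) (supp : Finset (ZdEdge 4) → Finset (Finset (ZdEdge 4)))
      (hmem : MemBallZdG (1 / 25) (1 / 50) R W supp) (hdep : ∀ X, DependsOn (W X) (↑X : Set (ZdEdge 4)))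
      (hg : ∀ X, IsZdGaugeInvariant (W X)) (hm : ∀ X, Measurable (W X)) (hb : ∀ X, ∃ C, ∀ U, |W X U| ≤ C),
      ∃ μ : Measure (LGConfig 4 (SUN 3)),
        perturbedGibbsMeasures (d := 4) (fundamentalRep (Fin 3)) (((3 : ℕ) : ℝ) * ((1 / 3 : ℝ) / 9)) W supp = {μ} ∧
        perturbedLimitPoints (((3 : ℕ) : ℝ) * ((1 / 3 : ℝ) / 9)) (periodisedFamily W supp hdep hg hm hb) = {μ} ∧
        IsMassiveState μ ∧ HasExponentialDecay (plaquetteCorrFn (fundamentalRep (Fin 3)) μ) ∧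
        HasAreaLawWith μ (fun g => normalisedCharacter 3 (fundamentalRep (Fin 3) g)) C c := by
  have hgap : MassGapOnBallZdG 4 3 ((1 / 3 : ℝ) / 9) (1 / 25) (1 / 50) R := by
    have h := su3_massGapOnBallZdG_pv2Star_oneThird R; norm_num at h ⊢; exact h
  exact su3_oneState_of_pv2Star_row (Ral := 2 / 9) (τ := 29 / 25) (Ks := 226971 / 100000) (s₀ := 547723 / 500000)
    (by norm_num) (by norm_num) (by norm_num) (by norm_num) (by norm_num) (by norm_num) (by norm_num) (by norm_num) (by norm_num) (by norm_num)
    (by norm_num) (by norm_num) hgap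

/-- **`SU(3)`, `ℤ⁴`, `β_W = 17/50`, HYPOTHESIS-FREE**: every member of the gauge-invariant tier-1 ball `MemBallZdG (11 / 500) (11 / 1000) R` added to
`SU(3)` Wilson at `β_W = 17/50` ('t Hooft `17 / 450`) has ONE state (unique DLR state = periodised-torus limit, massive, plaquette decay, area law;
one `(C, c)` per `R`) — `su3_massGapOnBallZdG_pv2Star_seventeenFiftieths` × the PV2 area law at the same loads (certificate `τ = 581 / 500`, `K_s = 229679 / 100000`,
`s₀ = 276079 / 250000`). [folklore] -/
theorem su3_oneState_pv2Star_seventeenFiftieths (R : ℕ) :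
    ∃ C c : ℝ, 0 < c ∧ ∀ (W : Potential (ZdEdge 4) (SUN 3)) (supp : Finset (ZdEdge 4) → Finset (Finset (ZdEdge 4)))
      (hmem : MemBallZdG (11 / 500) (11 / 1000) R W supp) (hdep : ∀ X, DependsOn (W X) (↑X : Set (ZdEdge 4)))
      (hg : ∀ X, IsZdGaugeInvariant (W X)) (hm : ∀ X, Measurable (W X)) (hb : ∀ X, ∃ C, ∀ U, |W X U| ≤ C),
      ∃ μ : Measure (LGConfig 4 (SUN 3)),
        perturbedGibbsMeasures (d := 4) (fundamentalRep (Fin 3)) (((3 : ℕ) : ℝ) * ((17 / 50 : ℝ) / 9)) W supp = {μ} ∧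
        perturbedLimitPoints (((3 : ℕ) : ℝ) * ((17 / 50 : ℝ) / 9)) (periodisedFamily W supp hdep hg hm hb) = {μ} ∧
        IsMassiveState μ ∧ HasExponentialDecay (plaquetteCorrFn (fundamentalRep (Fin 3)) μ) ∧
        HasAreaLawWith μ (fun g => normalisedCharacter 3 (fundamentalRep (Fin 3) g)) C c := by
  have hgap : MassGapOnBallZdG 4 3 ((17 / 50 : ℝ) / 9) (11 / 500) (11 / 1000) R := by
    have h := su3_massGapOnBallZdG_pv2Star_seventeenFiftieths R; norm_num at h ⊢; exact h
  exact su3_oneState_of_pv2Star_row (Ral := 17 / 75) (τ := 581 / 500) (Ks := 229679 / 100000) (s₀ := 276079 / 250000)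
    (by norm_num) (by norm_num) (by norm_num) (by norm_num) (by norm_num) (by norm_num) (by norm_num) (by norm_num) (by norm_num) (by norm_num)
    (by norm_num) (by norm_num) hgap

end Summit.Ventures.YMGap.RobustBall

end
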